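import Summits.QuantumFields.BalabanUV.T4Continuum.Support.NE7BalabanSoftOperator
import Summits.QuantumFields.BalabanUV.T4Continuum.Support.NE3QbarIterNearFlat
import HarnessLib

/-!
# NE7QbarSupRow — THE `ℓ^∞ → ℓ^∞` BOUND OF THE STRAIGHT AVERAGE ON THE SKEW TORUS 1-FORMS: `‖extF N (qbarOpK b)‖_∞ ≤ 2·L^{j+1}·‖extF b‖_∞` — the letter `c_Q` of F200's split
# (`NE7ConstrainedGreenRowsSplit`), DISCHARGED from row NE3's k-fold sup tower `NE3QbarIterNearFlat.norm_QbarIter_le_two_mul` (the factor `L^{j+1} = M` is the tree's unit-lattice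
# normalisation of `QbarIter`, cf. F202) (file 134 of the curved (APE), F205)

Cell `pub-balaban`, rung (B)+1 sub-cell t4, lineage `b2b-balaban-t4-ne7-p1` (CRUX PROVER NE7 #1 = OWNER of row NE7), generation 85; memo
`t4/b2b-balaban-t4-ne7-p1-g85/LAGRANGE-CARRIER.md` §9.  Over F192 `NE7BalabanSoftOperator.coe_qbarOpK` and row NE3's `NE3QbarIterNearFlat.norm_QbarIter_le_two_mul` BY NAME.
WHAT ([folklore]; 0 def, 0 sorry).  `norm_QbarIter_le_two_mul_global` (the global form of row NE3's local sup tower: `‖QbarIter L (k+1) W Y y μ‖ ≤ 2·L^{k+1}·‖Y‖_∞`),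
**`qbarOpK_supRow`** (`c_Q = 2·L^{j+1}` in F200's hypothesis shape `hQ`).
HONEST FRAMING (page 1): one instantiation of a row NE3 theorem; the adjoint's bound `c_Q*` and the rows of `G`, `(QGQ*)⁻¹` are NOT here; (KL-B) at curved `W` NOT proved; (APE) on
curved data NOT proved; NOT ONE-STEP, NOT NE7; spine 0∕9; finite T⁴ rung (B)+1 — NOT infinite volume, NOT mass gap, NOT `BetaPertH`, NOT Clay.  Continuum YM on T⁴ ⇐ BetaPertH ∧
nine spine estimates (0/9 proved); BetaPertH ⇐ (D1) ∧ (D4) ∧ CAP+tail; G-an2-4 gates asym, D1 and NE2/3/4.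
-/

set_option autoImplicit false

open scoped BigOperators Matrix Matrix.Norms.L2Operator
open Finset

namespace Summit.QuantumFields.BalabanUV.T4Continuum.NE7QbarSupRow

open Literature.MathematicalPhysics.QuantumFieldTheory.Balaban1983to89
open B7Prop1Explicit B7Prop2Explicit UnitaryModel
open T4AveragingDeficitWall (IsUnitaryCfg IsSkewDir SmallField)
open T4AveragingDeficitWallBoundary (periodBox IsPeriodicCfg)
open AveragingDeficitMultiLevelPrep (LevelSmall tower)
open AveragingDeficitMultiLevelBridge (tower_eq)
open AveragingDeficitPeriodicCounting (IsPeriodicDir)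
open NE3TangentCovariantTower (QbarIter)
open NE3FramePotBoundW (isPeriodicDir_QbarIter)
open NE3HilbertSchmidtTorus
open NE3QbarIterNearFlat (norm_QbarIter_le_two_mul)
open NE7BalabanSoftOperator

noncomputable section

variable {d : ℕ} {n : Type*} [Fintype n] [DecidableEq n]

/-- **THE GLOBAL SUP TOWER**: in the multi-level small-field class (`L ≥ 2`), `‖QbarIter L (k+1) W Y y μ‖ ≤ 2·L^{k+1}·s` whenever `‖Y‖_∞ ≤ s` — row NE3's local tower
`norm_QbarIter_le_two_mul` centred at the point itself (`m = 0`). [folklore] -/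
theorem norm_QbarIter_le_two_mul_global [Nonempty n] {L : ℕ} (hL : 2 ≤ L) (k : ℕ) {W : Site d → Fin d → (Matrix n n ℂ)ˣ} {x : ℝ}
    (hWu : IsUnitaryCfg W) (hx : 0 ≤ x) (hs : LevelSmall d L k x) (hWx : SmallField W x) (Y : Site d → Fin d → Matrix n n ℂ)
    {s : ℝ} (hs0 : 0 ≤ s) (hY : ∀ (x' : Site d) (μ : Fin d), ‖Y x' μ‖ ≤ s) (y : Site d) (μ : Fin d) :
    ‖QbarIter L (k + 1) W Y y μ‖ ≤ 2 * (L : ℝ) ^ (k + 1) * s := by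
  refine norm_QbarIter_le_two_mul hL k hWu hx hs hWx Y y hs0 (fun x' μ' _ => hY x' μ') (k + 1) 0 (by omega) y μ ?_
  simp [l1]

/-- **THE LETTER `c_Q` OF F200, DISCHARGED**: for a skew torus 1-form `b` of period `N·L^{j+1}` with `‖extF b‖_∞ ≤ g`, `‖extF N (qbarOpK b) y κ‖ ≤ (2·L^{j+1})·g` (`L ≥ 2`,
`W` unitary and `(N·L^{j+1})`-periodic in the multi-level small-field class). [folklore] -/
theorem qbarOpK_supRow [Nonempty n] {L N : ℕ} [NeZero N] (hL : 1 ≤ L) (hL2 : 2 ≤ L) (j : ℕ) [NeZero (N * L ^ (j + 1))]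
    {W : Site d → Fin d → (Matrix n n ℂ)ˣ} {x : ℝ} (hWu : IsUnitaryCfg W) (hWP : IsPeriodicCfg W ((N * L ^ (j + 1) : ℕ) : ℤ))
    (hx : 0 ≤ x) (hs : LevelSmall d L j x) (hWx : SmallField W x)
    (b : skewForms d n (N * L ^ (j + 1))) (g : ℝ) (hb : ∀ (y : Site d) (κ : Fin d), ‖extF (N * L ^ (j + 1)) (b : Form d n (N * L ^ (j + 1))) y κ‖ ≤ g)
    (y : Site d) (κ : Fin d) :
    ‖extF N ((qbarOpK (N := N) hL j hWu hx hs hWx b : skewForms d n N) : Form d n N) y κ‖ ≤ (2 * (L : ℝ) ^ (j + 1)) * g := by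
  have hg : 0 ≤ g := by
    classical
    exact (norm_nonneg _).trans (hb 0 κ)
  have htow : ((tower L N (j + 1) : ℕ) : ℤ) = ((N * L ^ (j + 1) : ℕ) : ℤ) := by rw [tower_eq]
  have hWP' : IsPeriodicCfg W ((tower L N (j + 1) : ℕ) : ℤ) := by rw [htow]; exact hWP
  have hbP : IsPeriodicDir (extF (N * L ^ (j + 1)) (b : Form d n (N * L ^ (j + 1)))) ((tower L N (j + 1) : ℕ) : ℤ) := by
    rw [htow]; exact isPeriodicDir_extF _ _
  have hQP := isPeriodicDir_QbarIter L N (j + 1) hWP' hbP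
  rw [coe_qbarOpK, extF_resF N hQP]
  exact norm_QbarIter_le_two_mul_global hL2 j hWu hx hs hWx _ hg hb y κ

end

end Summit.QuantumFields.BalabanUV.T4Continuum.NE7QbarSupRow
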